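import Mathlib.Tactic
import HarnessLib

/-!
# Kozma–Nitzan's Question 8 — the normalisation-mismatch term N4 of the merge step, every relay count (gen 33)

Support file (`--supports stmt-CriticalPhenomena-4575`, closed crux; independent mathematics on Kozma–Nitzan's Question 8,
arXiv:2401.12397 §5.5 p. 36), prover `prim-ineq-gen-6` (gen 33).  No definitions, no named facts, no sorries; standard axioms.
Memo `run/shared/lean/prim/prim-ineq-gen-6/PROOF-UNIFG-G33.md` §2.

In the bookkeeping BEY-III(2) ⟹ (R3) ⟹ (M‴) ⟹ (M′) of the merge induction for the uniform form (FINDING-G31 §5g, PROOF-BEY2-G32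
CAVEAT) one term was left: `N4 = sW·Y⁺·pAC((1−C)u−v)⁺/(p₀p_m)`, the mismatch between the depth-0 observer lens of the block and
of the merged block.  The memo bounds it, depth by depth, by the part of the kill budget that the proof of BEY-III(2) does not use
(`⅔` of the vertex-1 R-share, the quadratic R-residue `¾(1−a_l)²/a_l`, the linear residue `(1−a_l)/(4(1+λ))` of CORE g, the
badness budget `A(1−C)τ`, and the L-kill `L_l`).  This file certifies the real-arithmetic skeleton of that bound:
`kN4_chain_a` (N4 against the A-bad lens `ρ = Cu/p_m`), `kN4_Apart` (the vertex-1 A-defect part fits in half the unused R-share),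
`kN4_rho_split` (the lens splits into prefix defect + deep A-bad mass), `kN4_T_core` (the deep part against the L-kill, using the
shallow regime `S(1−x)v′ ≤ λ′m`), `kN4_core_p0` / `kN4_core_p1` (the two endpoint polynomial inequalities; `p = 1` is a sum of
squares), and `kN4_apart` (assembly of the per-depth a-part from these pieces, affine interpolation in `p`).
[cite: KozmaNitzan2024, Question 8 (§5.5 p. 36)]
-/

namespace Summit.CriticalPhenomena.PercolationContinuityZ3.Theorems

namespace PocketCert

/-- **(N4-a)** in product form.  With `W = 1−λ`, `0 ≤ λ ≤ 1`, `s·p_m ≤ p₀`, the shallow-regime bound `p ≤ (1+λ)p_m`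
(from `p ≤ u+(1+λ′)m`, `p_m ≥ C(u+m)`, `(1+λ′) = (1+λ)C`), and `E ≤ (1−C)u` (for `E = ((1−C)u−v)⁺`):
`sW·Y·p·A·C·E ≤ (1−λ²)·A·(1−C)·C·u·Y·p₀`, i.e. `N4 ≤ (1−λ²)A(1−C)ρY⁺` with `ρ = Cu/p_m` after dividing by `p₀p_m`.
[cite: KozmaNitzan2024, Question 8 (§5.5 p. 36)] -/
theorem kN4_chain_a (s W Y p A C E u p0 pm lam : ℝ)
    (hs : 0 ≤ s) (hW : W = 1 - lam) (hl0 : 0 ≤ lam) (hl1 : lam ≤ 1) (hY : 0 ≤ Y) (hp : 0 ≤ p)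
    (hA : 0 ≤ A) (hC0 : 0 ≤ C) (hC1 : C ≤ 1) (hu : 0 ≤ u) (hE : E ≤ (1 - C) * u)
    (hsp : s * pm ≤ p0) (hpp : p ≤ (1 + lam) * pm) :
    s * W * Y * p * A * C * E ≤ (1 - lam ^ 2) * A * (1 - C) * C * u * Y * p0 := by
  -- s·p ≤ (1+λ)·s·p_m ≤ (1+λ)·p₀
  have h1 : s * p ≤ (1 + lam) * p0 := by
    have : s * p ≤ s * ((1 + lam) * pm) := mul_le_mul_of_nonneg_left hpp hs
    nlinarith
  have hW0 : 0 ≤ W := by rw [hW]; linarith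
  -- group: LHS = (W·Y·A·C) · E · (s p)
  have h2 : s * W * Y * p * A * C * E = (W * Y * A * C) * E * (s * p) := by ring
  have hK : 0 ≤ W * Y * A * C := by positivity
  have h1C : 0 ≤ 1 - C := by linarith
  have h3 : (W * Y * A * C) * E * (s * p) ≤ (W * Y * A * C) * ((1 - C) * u) * ((1 + lam) * p0) := by
    apply mul_le_mul (mul_le_mul_of_nonneg_left hE hK) h1 (by positivity)
    exact mul_nonneg hK (mul_nonneg h1C hu)
  have h4 : (W * Y * A * C) * ((1 - C) * u) * ((1 + lam) * p0)
      = (1 - lam ^ 2) * A * (1 - C) * C * u * Y * p0 := by rw [hW]; ring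
  linarith [h2, h3, h4]

/-- **(N4-c), the vertex-1 A-defect part.**  For `0 ≤ λ ≤ 1`, `(1+λ)C ≥ 1`, `C ≤ 1`, `0 ≤ A ≤ 1`, `0 ≤ ρ ≤ 1` and a depth with
`0 < a ≤ 1`, `0 < p_l ≤ 1`:  `2·(1−λ²)(1+λ)(1−C)·A·ρ·(1−A)·(A·a·p_l) ≤ 1−A`, i.e. the demand
`(1−λ²)(1+λ)A(1−C)ρ(1−A)` is at most the unused half R-share `½(1−A)/(A a p_l)` (`λ(1−λ²) ≤ ½`).
[cite: KozmaNitzan2024, Question 8 (§5.5 p. 36)] -/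
theorem kN4_Apart (lam C A ρ a pl : ℝ) (hl0 : 0 ≤ lam) (hl1 : lam ≤ 1) (hC : 1 ≤ (1 + lam) * C) (hC1 : C ≤ 1)
    (hA0 : 0 ≤ A) (hA1 : A ≤ 1) (hr0 : 0 ≤ ρ) (hr1 : ρ ≤ 1) (ha0 : 0 ≤ a) (ha1 : a ≤ 1) (hp0 : 0 ≤ pl) (hp1 : pl ≤ 1) :
    2 * ((1 - lam ^ 2) * (1 + lam) * (1 - C) * A * ρ * (1 - A)) * (A * a * pl) ≤ 1 - A := by
  -- (1+λ)(1−C) ≤ λ, λ(1−λ²) ≤ 1/2, and every other factor is in [0,1]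
  have h1 : (1 + lam) * (1 - C) ≤ lam := by nlinarith
  have h2 : lam * (1 - lam ^ 2) ≤ 1 / 2 := by nlinarith [sq_nonneg (lam - 1 / 2), sq_nonneg lam, mul_nonneg hl0 (sq_nonneg (lam - 1/2))]
  have hA1' : 0 ≤ 1 - A := by linarith
  have h3 : A * ρ ≤ 1 := by nlinarith [mul_le_mul hA1 hr1 hr0 (by norm_num : (0:ℝ) ≤ 1)]
  have h4 : A * a * pl ≤ 1 := by
    have : A * a ≤ 1 := by nlinarith [mul_le_mul hA1 ha1 ha0 (by norm_num : (0:ℝ) ≤ 1)]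
    nlinarith [mul_le_mul this hp1 hp0 (by norm_num : (0:ℝ) ≤ 1), mul_nonneg hA0 ha0]
  have h5 : (1 - lam ^ 2) * (1 + lam) * (1 - C) ≤ lam * (1 - lam ^ 2) := by
    have : 0 ≤ 1 - lam ^ 2 := by nlinarith
    nlinarith [mul_le_mul_of_nonneg_left h1 this]
  have h6 : 0 ≤ (1 - lam ^ 2) * (1 + lam) * (1 - C) := by
    have : 0 ≤ 1 - lam ^ 2 := by nlinarith
    have : 0 ≤ 1 - C := by linarith
    positivity
  -- assemble: LHS = 2·[(1−λ²)(1+λ)(1−C)]·(Aρ)·(A a p_l)·(1−A)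
  have h7 : 2 * ((1 - lam ^ 2) * (1 + lam) * (1 - C) * A * ρ * (1 - A)) * (A * a * pl)
      = 2 * ((1 - lam ^ 2) * (1 + lam) * (1 - C)) * (A * ρ) * (A * a * pl) * (1 - A) := by ring
  rw [h7]
  have h8 : ((1 - lam ^ 2) * (1 + lam) * (1 - C)) * (A * ρ) ≤ 1 / 2 * 1 := by
    apply mul_le_mul (by linarith) h3 (by positivity) (by norm_num)
  have h9 : ((1 - lam ^ 2) * (1 + lam) * (1 - C)) * (A * ρ) * (A * a * pl) ≤ 1 / 2 * 1 * 1 := by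
    apply mul_le_mul h8 h4 (by positivity) (by norm_num)
  nlinarith [mul_nonneg (mul_nonneg (mul_nonneg h6 (mul_nonneg hA0 hr0)) (mul_nonneg (mul_nonneg hA0 ha0) hp0)) hA1']

/-- **(N4-d), lens split.**  If the A-bad C-good mass satisfies `u ≤ x·g + (1−x)·D` (prefix A-defect `x = 1−a_l` acting on the
C-good mass `g = u+m`, plus the deep A-bad mass `D = S·κ′_l·u_{l+1}` through an A-good prefix) and `p_m ≥ C·g`, then
`C·u ≤ x·p_m + (1−x)·(C·D)`, i.e. `ρ = Cu/p_m ≤ x + (1−x)·Q/p_m` with `Q = C·D`.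
[cite: KozmaNitzan2024, Question 8 (§5.5 p. 36)] -/
theorem kN4_rho_split (u x g D pm C : ℝ) (hC : 0 ≤ C) (hx0 : 0 ≤ x)
    (hu : u ≤ x * g + (1 - x) * D) (hpm : C * g ≤ pm) :
    C * u ≤ x * pm + (1 - x) * (C * D) := by
  have h1 : C * u ≤ C * (x * g + (1 - x) * D) := mul_le_mul_of_nonneg_left hu hC
  nlinarith [mul_le_mul_of_nonneg_left hpm hx0]

/-- **(N4-d), the deep part against the L-kill (core).**  Shallow regime consequence `S(1−x)v′ ≤ λ′m` (root class reaching
`b_{l+1}` A-good with a C-bad far class), `λ′ ≤ λ`, merged good mass `p_m ≥ A·m` (`p_m ≥ M₁m`, `M₁ ≥ A`), prefix C-product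
`κ = C·κ′ ≤ C ≤ 1`, `κ′ ≤ 1`, far good mass `p′ ≤ 1`, everything nonnegative:
`(1−C)·A·(1−x)·S·κ′·κ·p′·v′ ≤ (1−κ)·λ·p_m`.  Multiplying by `(1−λ²)(1+λ)·x·A·C·p·λ·u′/(p_m κ p′ v′)` this is
`T·pλ ≤ (1−λ²)(1+λ)x·L̂_l` for `T = K₀x(1−x)Q/p_m`, `L̂_l = ACp(1−κ)λ²u′/(κp′v′)` (memo §2 (d)).
[cite: KozmaNitzan2024, Question 8 (§5.5 p. 36)] -/
theorem kN4_T_core (C A x S kp κ p' v' lam lamp m pm : ℝ)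
    (hC0 : 0 ≤ C) (hC1 : C ≤ 1) (hA0 : 0 ≤ A) (hx1 : x ≤ 1) (hS0 : 0 ≤ S) (hkp0 : 0 ≤ kp) (hkp1 : kp ≤ 1)
    (hk : κ = C * kp) (hk0 : 0 ≤ κ) (hp0 : 0 ≤ p') (hp1 : p' ≤ 1) (hv0 : 0 ≤ v')
    (hl0 : 0 ≤ lam) (hlamp : lamp ≤ lam) (hm : 0 ≤ m) (hreg : S * (1 - x) * v' ≤ lamp * m) (hpm : A * m ≤ pm) :
    (1 - C) * A * (1 - x) * S * kp * κ * p' * v' ≤ (1 - κ) * lam * pm := by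
  -- 1 − C ≤ 1 − κ since κ = C κ′ ≤ C
  have hkC : κ ≤ C := by rw [hk]; nlinarith
  have h1C : 1 - C ≤ 1 - κ := by linarith
  have h1k0 : 0 ≤ 1 - κ := by linarith
  -- S(1−x)v′ ≤ λ′ m ≤ λ m
  have hreg' : S * (1 - x) * v' ≤ lam * m := le_trans hreg (mul_le_mul_of_nonneg_right hlamp hm)
  have hSxv : 0 ≤ S * (1 - x) * v' := by
    have : 0 ≤ 1 - x := by linarith
    positivity
  -- LHS = (1−C)·(κ′ κ p′)·A·[S(1−x)v′] ≤ (1−κ)·1·[λ·(A m)] ≤ (1−κ)λ p_m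
  have hkkp : kp * κ * p' ≤ 1 := by
    have hk1 : κ ≤ 1 := le_trans hkC hC1
    have : kp * κ ≤ 1 := by nlinarith [mul_le_mul hkp1 hk1 hk0 (by norm_num : (0:ℝ) ≤ 1)]
    nlinarith [mul_le_mul this hp1 hp0 (by norm_num : (0:ℝ) ≤ 1), mul_nonneg hkp0 hk0]
  have hkkp0 : 0 ≤ kp * κ * p' := by positivity
  have e1 : (1 - C) * A * (1 - x) * S * kp * κ * p' * v' = (1 - C) * (kp * κ * p') * (A * (S * (1 - x) * v')) := by ring
  rw [e1]
  have h2 : A * (S * (1 - x) * v') ≤ A * (lam * m) := mul_le_mul_of_nonneg_left hreg' hA0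
  have h4 : (1 - C) * (kp * κ * p') ≤ (1 - κ) * 1 := by
    apply mul_le_mul h1C hkkp hkkp0 h1k0
  have h5 : (1 - C) * (kp * κ * p') * (A * (S * (1 - x) * v')) ≤ ((1 - κ) * 1) * (A * (lam * m)) := by
    apply mul_le_mul h4 h2 (by positivity) (by linarith)
  have h6 : ((1 - κ) * 1) * (A * (lam * m)) ≤ (1 - κ) * lam * pm := by
    have : lam * (A * m) ≤ lam * pm := mul_le_mul_of_nonneg_left hpm hl0
    nlinarith
  linarith [h5, h6]

/-- **CORE p = 1** (sum of squares).  For `0 ≤ λ ≤ 1` and `x ≥ 0`: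
`F(λ,x) := ¾(1+λ)x² + x(1−x)/4 − λ(1−λ²)(1+λ)·x(1−x) + λ²(1−x)² ≥ 0`.
Indeed `F = (λ − t·x)² + x/4 + g(λ)·x²` with `t = λ + (1−λ)(1+λ)²/2` and
`g = ¼ + ¼λ + ¼λ² + λ³ + ¼λ⁴ − ½λ⁵ − ¼λ⁶ ≥ ¼` on `[0,1]` (F is quadratic in `x`).
[cite: KozmaNitzan2024, Question 8 (§5.5 p. 36)] -/
theorem kN4_core_p1 (lam x : ℝ) (hl0 : 0 ≤ lam) (hl1 : lam ≤ 1) (hx0 : 0 ≤ x) :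
    0 ≤ 3 / 4 * (1 + lam) * x ^ 2 + x * (1 - x) / 4 - lam * (1 - lam ^ 2) * (1 + lam) * (x * (1 - x))
      + lam ^ 2 * (1 - x) ^ 2 := by
  have key : 3 / 4 * (1 + lam) * x ^ 2 + x * (1 - x) / 4 - lam * (1 - lam ^ 2) * (1 + lam) * (x * (1 - x))
      + lam ^ 2 * (1 - x) ^ 2
      = (lam - (lam + (1 - lam) * (1 + lam) ^ 2 / 2) * x) ^ 2 + x / 4
        + (1 / 4 + lam / 4 + lam ^ 2 / 4 + lam ^ 3 + lam ^ 4 / 4 - lam ^ 5 / 2 - lam ^ 6 / 4) * x ^ 2 := by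
    ring
  rw [key]
  have hl3 : 0 ≤ lam ^ 3 := by positivity
  have h5 : lam ^ 5 ≤ lam ^ 3 := by
    have : lam ^ 5 = lam ^ 3 * lam ^ 2 := by ring
    rw [this]; apply mul_le_of_le_one_right hl3; nlinarith
  have h6 : lam ^ 6 ≤ lam ^ 3 := by
    have : lam ^ 6 = lam ^ 3 * lam ^ 3 := by ring
    rw [this]; apply mul_le_of_le_one_right hl3
    calc lam ^ 3 ≤ 1 ^ 3 := by gcongr
      _ = 1 := by norm_num
  have hg : 0 ≤ 1 / 4 + lam / 4 + lam ^ 2 / 4 + lam ^ 3 + lam ^ 4 / 4 - lam ^ 5 / 2 - lam ^ 6 / 4 := by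
    nlinarith [sq_nonneg lam, sq_nonneg (lam ^ 2)]
  have := mul_nonneg hg (sq_nonneg x)
  nlinarith [sq_nonneg (lam - (lam + (1 - lam) * (1 + lam) ^ 2 / 2) * x)]

/-- **CORE p = 0** (the badness endpoint).  For `0 ≤ λ ≤ 1`, `(1+λ)C ≥ 1`, `C ≤ 1`, `0 ≤ A ≤ 1`, `0 ≤ x < 1`,
`ν = (1−λ²)(1+λ)`:  `(1−C)A²·ν·x ≤ ¾x²/(1−x) + x/(4(1+λ)) + A(1−C)`
(`νx = νx(1−x) + νx²`, `ν/4 ≤ ½`, `(1+λ)(1−C)(1−λ²) ≤ λ(1−λ²) ≤ ¾`).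
[cite: KozmaNitzan2024, Question 8 (§5.5 p. 36)] -/
theorem kN4_core_p0 (lam C A x : ℝ) (hl0 : 0 ≤ lam) (hl1 : lam ≤ 1) (hC : 1 ≤ (1 + lam) * C) (hC1 : C ≤ 1)
    (hA0 : 0 ≤ A) (hA1 : A ≤ 1) (hx0 : 0 ≤ x) (hx1 : x < 1) :
    (1 - C) * A ^ 2 * ((1 - lam ^ 2) * (1 + lam) * x)
      ≤ 3 / 4 * x ^ 2 / (1 - x) + x / (4 * (1 + lam)) + A * (1 - C) := by
  have h1x : 0 < 1 - x := by linarith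
  have h1l : 0 < 1 + lam := by linarith
  have hcl : (1 + lam) * (1 - C) ≤ lam := by nlinarith
  have hc0 : 0 ≤ 1 - C := by linarith
  have hnu0 : 0 ≤ (1 - lam ^ 2) := by nlinarith
  have hnu2 : (1 - lam ^ 2) * (1 + lam) ≤ 2 := by nlinarith
  have hq : 3 / 4 * x ^ 2 ≤ 3 / 4 * x ^ 2 / (1 - x) := by
    rw [le_div_iff₀ h1x]; nlinarith [sq_nonneg x]
  have hlin : 0 ≤ x / (4 * (1 + lam)) := by positivity
  have e : (1 - C) * A ^ 2 * ((1 - lam ^ 2) * (1 + lam) * x)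
      = (1 - C) * A ^ 2 * ((1 - lam ^ 2) * (1 + lam)) * (x * (1 - x))
        + ((1 + lam) * (1 - C)) * (1 - lam ^ 2) * A ^ 2 * x ^ 2 := by ring
  have hxx : x * (1 - x) ≤ 1 / 4 := by nlinarith [sq_nonneg (x - 1 / 2)]
  have hxx0 : 0 ≤ x * (1 - x) := by nlinarith
  have hA2 : A ^ 2 ≤ A := by nlinarith
  have t1a : (1 - C) * A ^ 2 * ((1 - lam ^ 2) * (1 + lam)) ≤ (1 - C) * A * 2 := by
    have := mul_le_mul (mul_le_mul_of_nonneg_left hA2 hc0) hnu2 (by positivity) (by positivity)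
    linarith
  have t1 : (1 - C) * A ^ 2 * ((1 - lam ^ 2) * (1 + lam)) * (x * (1 - x)) ≤ (1 - C) * A * 2 * (1 / 4) :=
    mul_le_mul t1a hxx hxx0 (by positivity)
  have s1 : ((1 + lam) * (1 - C)) * (1 - lam ^ 2) ≤ lam * (1 - lam ^ 2) := mul_le_mul_of_nonneg_right hcl hnu0
  have s2 : A ^ 2 ≤ 1 := by nlinarith
  have s3 : ((1 + lam) * (1 - C)) * (1 - lam ^ 2) * A ^ 2 ≤ lam * (1 - lam ^ 2) * 1 :=
    mul_le_mul s1 s2 (by positivity) (by positivity)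
  have t2 : ((1 + lam) * (1 - C)) * (1 - lam ^ 2) * A ^ 2 * x ^ 2 ≤ lam * (1 - lam ^ 2) * 1 * x ^ 2 :=
    mul_le_mul_of_nonneg_right s3 (sq_nonneg x)
  have t3 : lam * (1 - lam ^ 2) ≤ 3 / 4 := by nlinarith [sq_nonneg (lam - 1 / 2)]
  have t4 : lam * (1 - lam ^ 2) * 1 * x ^ 2 ≤ 3 / 4 * x ^ 2 := by nlinarith [sq_nonneg x]
  have t5 : (1 - C) * A * 2 * (1 / 4) ≤ A * (1 - C) := by nlinarith [mul_nonneg hc0 hA0]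
  rw [e]; linarith

/-- **CORE p = 1, divided form.**  For `0 ≤ λ ≤ 1`, `(1+λ)C ≥ 1`, `C ≤ 1`, `0 ≤ A ≤ 1`, `0 ≤ x < 1`, `ν = (1−λ²)(1+λ)`:
`(1−C)A²·(νx − (1−x)λ) ≤ ¾x²/(1−x) + x/(4(1+λ))` — `(1−C)A² ≤ λ/(1+λ)` and `kN4_core_p1`.
[cite: KozmaNitzan2024, Question 8 (§5.5 p. 36)] -/
theorem kN4_core_p1d (lam C A x : ℝ) (hl0 : 0 ≤ lam) (hl1 : lam ≤ 1) (hC : 1 ≤ (1 + lam) * C) (hC1 : C ≤ 1)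
    (hA0 : 0 ≤ A) (hA1 : A ≤ 1) (hx0 : 0 ≤ x) (hx1 : x < 1) :
    (1 - C) * A ^ 2 * ((1 - lam ^ 2) * (1 + lam) * x - (1 - x) * lam)
      ≤ 3 / 4 * x ^ 2 / (1 - x) + x / (4 * (1 + lam)) := by
  have h1x : 0 < 1 - x := by linarith
  have h1l : 0 < 1 + lam := by linarith
  have hc0 : 0 ≤ 1 - C := by linarith
  have hq : 3 / 4 * x ^ 2 ≤ 3 / 4 * x ^ 2 / (1 - x) := by
    rw [le_div_iff₀ h1x]; nlinarith [sq_nonneg x]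
  have hlin : 0 ≤ x / (4 * (1 + lam)) := by positivity
  rcases le_or_gt ((1 - lam ^ 2) * (1 + lam) * x - (1 - x) * lam) 0 with hneg | hpos
  · have : (1 - C) * A ^ 2 * ((1 - lam ^ 2) * (1 + lam) * x - (1 - x) * lam) ≤ 0 := by
      have : 0 ≤ (1 - C) * A ^ 2 := by positivity
      nlinarith
    nlinarith [hq, hlin, sq_nonneg x]
  · have hF := kN4_core_p1 lam x hl0 hl1 hx0
    -- (1−C)A² ≤ λ/(1+λ)
    have hcA : (1 - C) * A ^ 2 ≤ lam / (1 + lam) := by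
      rw [le_div_iff₀ h1l]
      have : A ^ 2 ≤ 1 := by nlinarith
      nlinarith [mul_le_mul_of_nonneg_left this hc0]
    have h1 : (1 - C) * A ^ 2 * ((1 - lam ^ 2) * (1 + lam) * x - (1 - x) * lam)
        ≤ lam / (1 + lam) * ((1 - lam ^ 2) * (1 + lam) * x - (1 - x) * lam) :=
      mul_le_mul_of_nonneg_right hcA hpos.le
    -- λ·B·(1−x) ≤ ¾(1+λ)x² + x(1−x)/4  is CORE p = 1 rearranged
    have e1 : lam * ((1 - lam ^ 2) * (1 + lam) * x - (1 - x) * lam) * (1 - x)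
        = lam * (1 - lam ^ 2) * (1 + lam) * (x * (1 - x)) - lam ^ 2 * (1 - x) ^ 2 := by ring
    have h2 : lam * ((1 - lam ^ 2) * (1 + lam) * x - (1 - x) * lam) * (1 - x)
        ≤ 3 / 4 * (1 + lam) * x ^ 2 + x * (1 - x) / 4 := by rw [e1]; linarith
    have e2 : lam / (1 + lam) * ((1 - lam ^ 2) * (1 + lam) * x - (1 - x) * lam)
        = (lam * ((1 - lam ^ 2) * (1 + lam) * x - (1 - x) * lam) * (1 - x)) / ((1 + lam) * (1 - x)) := by
      field_simp
    have e3 : 3 / 4 * x ^ 2 / (1 - x) + x / (4 * (1 + lam))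
        = (3 / 4 * (1 + lam) * x ^ 2 + x * (1 - x) / 4) / ((1 + lam) * (1 - x)) := by
      field_simp
    have hden : 0 < (1 + lam) * (1 - x) := by positivity
    have h3 : (lam * ((1 - lam ^ 2) * (1 + lam) * x - (1 - x) * lam) * (1 - x)) / ((1 + lam) * (1 - x))
        ≤ (3 / 4 * (1 + lam) * x ^ 2 + x * (1 - x) / 4) / ((1 + lam) * (1 - x)) := by
      gcongr
    linarith [h1, e2, e3, h3]

/-- **CORE (final scalar of the N4 a-part).**  For `0 ≤ λ ≤ 1`, `(1+λ)C ≥ 1`, `C ≤ 1`, `0 ≤ A ≤ 1`, `0 ≤ x < 1`, `0 ≤ p ≤ 1`,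
with `ν = (1−λ²)(1+λ)`:
`(1−C)A²·(νx − (1−x)pλ) ≤ ¾x²/(1−x) + x/(4(1+λ)) + A(1−C)(1−p)`  — affine in `p`, endpoints `kN4_core_p0`, `kN4_core_p1d`.
[cite: KozmaNitzan2024, Question 8 (§5.5 p. 36)] -/
theorem kN4_core (lam C A x p : ℝ) (hl0 : 0 ≤ lam) (hl1 : lam ≤ 1) (hC : 1 ≤ (1 + lam) * C) (hC1 : C ≤ 1)
    (hA0 : 0 ≤ A) (hA1 : A ≤ 1) (hx0 : 0 ≤ x) (hx1 : x < 1) (hp0 : 0 ≤ p) (hp1 : p ≤ 1) :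
    (1 - C) * A ^ 2 * ((1 - lam ^ 2) * (1 + lam) * x - (1 - x) * p * lam)
      ≤ 3 / 4 * x ^ 2 / (1 - x) + x / (4 * (1 + lam)) + A * (1 - C) * (1 - p) := by
  have hP0 := kN4_core_p0 lam C A x hl0 hl1 hC hC1 hA0 hA1 hx0 hx1
  have hP1 := kN4_core_p1d lam C A x hl0 hl1 hC hC1 hA0 hA1 hx0 hx1
  set L0 := (1 - C) * A ^ 2 * ((1 - lam ^ 2) * (1 + lam) * x) with hL0
  set L1 := (1 - C) * A ^ 2 * ((1 - lam ^ 2) * (1 + lam) * x - (1 - x) * lam) with hL1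
  set R1 := 3 / 4 * x ^ 2 / (1 - x) + x / (4 * (1 + lam)) with hR1
  have e1 : (1 - C) * A ^ 2 * ((1 - lam ^ 2) * (1 + lam) * x - (1 - x) * p * lam)
      = (1 - p) * L0 + p * L1 := by rw [hL0, hL1]; ring
  have e2 : R1 + A * (1 - C) * (1 - p) = (1 - p) * (R1 + A * (1 - C)) + p * R1 := by ring
  rw [e1, e2]
  have hp1' : 0 ≤ 1 - p := by linarith
  have t0 := mul_le_mul_of_nonneg_left hP0 hp1'
  have t1 := mul_le_mul_of_nonneg_left hP1 hp0
  linarith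

/-- **The per-depth a-part of the N4 bound (assembly).**  Abstract reals: `λ ∈ [0,1]`, `(1+λ)C ≥ 1 ≥ C`, `A ∈ [0,1]`,
prefix A-defect `x = 1 − a_l ∈ [0,1)`, far good mass `p ∈ [0,1]`, truncated defect `ā ∈ [0,x]`, lens `ρ ≤ x + (1−x)Q_r` with
`Q_r = Q/p_m ∈ [0,1]` (`kN4_rho_split`), L-budget `L̂ ≥ 0` with the regime bound `T·pλ ≤ νx·L̂` (`kN4_T_core`), `ν = (1−λ²)(1+λ)`,
`T = ν(1−C)A²·x(1−x)Q_r`.  Then the demand `ν(1−C)A²·ρ·ā` fits in the unused per-depth budget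
`¾x²/(1−x) + x/(4(1+λ)) + A(1−C)(1−p) + L̂` (memo §2 (d): quadratic R-residue, CORE-g residue, badness budget, L-kill).
[cite: KozmaNitzan2024, Question 8 (§5.5 p. 36)] -/
theorem kN4_apart (lam C A x p abar ρ Qr Lh : ℝ) (hl0 : 0 ≤ lam) (hl1 : lam ≤ 1)
    (hC : 1 ≤ (1 + lam) * C) (hC1 : C ≤ 1) (hA0 : 0 ≤ A) (hA1 : A ≤ 1)
    (hx0 : 0 ≤ x) (hx1 : x < 1) (hp0 : 0 ≤ p) (hp1 : p ≤ 1) (hab0 : 0 ≤ abar) (hab : abar ≤ x)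
    (hr0 : 0 ≤ ρ) (hr : ρ ≤ x + (1 - x) * Qr) (hQ0 : 0 ≤ Qr) (hQ1 : Qr ≤ 1) (hL : 0 ≤ Lh)
    (hT : (1 - lam ^ 2) * (1 + lam) * (1 - C) * A ^ 2 * x * (1 - x) * Qr * (p * lam)
      ≤ (1 - lam ^ 2) * (1 + lam) * x * Lh) :
    (1 - lam ^ 2) * (1 + lam) * (1 - C) * A ^ 2 * ρ * abar
      ≤ 3 / 4 * x ^ 2 / (1 - x) + x / (4 * (1 + lam)) + A * (1 - C) * (1 - p) + Lh := by
  have hcore := kN4_core lam C A x p hl0 hl1 hC hC1 hA0 hA1 hx0 hx1 hp0 hp1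
  have hn2 : 0 ≤ 1 - lam ^ 2 := by nlinarith
  have hcl : (1 + lam) * (1 - C) ≤ lam := by nlinarith
  -- make ν an opaque variable
  obtain ⟨ν, hν⟩ : ∃ ν : ℝ, ν = (1 - lam ^ 2) * (1 + lam) := ⟨_, rfl⟩
  rw [← hν] at hT hcore ⊢
  have h1x : 0 < 1 - x := by linarith
  have h1l : 0 < 1 + lam := by linarith
  have hc0 : 0 ≤ 1 - C := by linarith
  have hν0 : 0 ≤ ν := by rw [hν]; positivity
  have hK0 : 0 ≤ ν * (1 - C) * A ^ 2 := by positivity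
  have hxQ : 0 ≤ x + (1 - x) * Qr := by
    have : 0 ≤ (1 - x) * Qr := mul_nonneg h1x.le hQ0
    linarith
  -- step 1: K₀ρā ≤ K₀x² + T
  have hρx : ρ * abar ≤ (x + (1 - x) * Qr) * x := mul_le_mul hr hab hab0 hxQ
  have step1 : ν * (1 - C) * A ^ 2 * ρ * abar
      ≤ ν * (1 - C) * A ^ 2 * x ^ 2 + ν * (1 - C) * A ^ 2 * x * (1 - x) * Qr := by
    have h := mul_le_mul_of_nonneg_left hρx hK0
    have e : ν * (1 - C) * A ^ 2 * ((x + (1 - x) * Qr) * x)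
        = ν * (1 - C) * A ^ 2 * x ^ 2 + ν * (1 - C) * A ^ 2 * x * (1 - x) * Qr := by ring
    have e' : ν * (1 - C) * A ^ 2 * ρ * abar = ν * (1 - C) * A ^ 2 * (ρ * abar) := by ring
    rw [e', ← e]; exact h
  have hq : 3 / 4 * x ^ 2 ≤ 3 / 4 * x ^ 2 / (1 - x) := by
    rw [le_div_iff₀ h1x]
    have : 3 / 4 * x ^ 2 * (1 - x) = 3 / 4 * x ^ 2 - 3 / 4 * x ^ 2 * x := by ring
    rw [this]
    have : 0 ≤ 3 / 4 * x ^ 2 * x := by positivity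
    linarith
  -- K₀ ≤ ¾, hence K₀x² ≤ ¾x²
  have hK034 : ν * (1 - C) * A ^ 2 ≤ 3 / 4 := by
    have e : ν * (1 - C) * A ^ 2 = ((1 + lam) * (1 - C)) * (1 - lam ^ 2) * A ^ 2 := by rw [hν]; ring
    have s2 : A ^ 2 ≤ 1 := by nlinarith
    have s3 : ((1 + lam) * (1 - C)) * (1 - lam ^ 2) * A ^ 2 ≤ lam * (1 - lam ^ 2) * 1 :=
      mul_le_mul (mul_le_mul_of_nonneg_right hcl hn2) s2 (by positivity) (by positivity)
    have t3 : lam * (1 - lam ^ 2) ≤ 3 / 4 := by nlinarith [sq_nonneg (lam - 1 / 2)]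
    rw [e]; linarith
  have hK0x2 : ν * (1 - C) * A ^ 2 * x ^ 2 ≤ 3 / 4 * x ^ 2 := mul_le_mul_of_nonneg_right hK034 (sq_nonneg x)
  have hbud0 : 0 ≤ x / (4 * (1 + lam)) := by positivity
  have hp1' : 0 ≤ 1 - p := by linarith
  have hbud1 : 0 ≤ A * (1 - C) * (1 - p) := by positivity
  have hT0 : 0 ≤ ν * (1 - C) * A ^ 2 * x * (1 - x) * Qr := by positivity
  -- step 2: split on pλ ≥ νx
  rcases le_or_gt (ν * x) (p * lam) with hbig | hsmall
  · -- T ≤ L̂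
    have hTL : ν * (1 - C) * A ^ 2 * x * (1 - x) * Qr ≤ Lh := by
      rcases eq_or_lt_of_le (mul_nonneg hν0 hx0) with hz | hpos
      · have e : ν * (1 - C) * A ^ 2 * x * (1 - x) * Qr = (ν * x) * ((1 - C) * A ^ 2 * (1 - x) * Qr) := by ring
        rw [e, ← hz, zero_mul]; exact hL
      · have hpl : 0 < p * lam := lt_of_lt_of_le hpos hbig
        have h2 : ν * x * Lh ≤ p * lam * Lh := mul_le_mul_of_nonneg_right hbig hL
        have h3 : ν * (1 - C) * A ^ 2 * x * (1 - x) * Qr * (p * lam) ≤ Lh * (p * lam) := by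
          have := le_trans hT h2
          rw [mul_comm Lh]; exact this
        exact le_of_mul_le_mul_right h3 hpl
    have : ν * (1 - C) * A ^ 2 * ρ * abar ≤ 3 / 4 * x ^ 2 / (1 - x) + Lh := by linarith [step1, hTL, hK0x2, hq]
    linarith [this, hbud0, hbud1]
  · -- pλ < νx:  T·(νx) = T·pλ + T·(νx − pλ) ≤ νx·L̂ + K₀x(1−x)·(νx − pλ)
    have hνx : 0 < ν * x := lt_of_le_of_lt (mul_nonneg hp0 hl0) hsmall
    have hTK : ν * (1 - C) * A ^ 2 * x * (1 - x) * Qr ≤ ν * (1 - C) * A ^ 2 * x * (1 - x) := by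
      have h0 : 0 ≤ ν * (1 - C) * A ^ 2 * x * (1 - x) := by positivity
      have := mul_le_mul_of_nonneg_left hQ1 h0
      rw [mul_one] at this; exact this
    have hd : 0 ≤ ν * x - p * lam := by linarith
    have hsplit : ν * (1 - C) * A ^ 2 * x * (1 - x) * Qr * (ν * x)
        ≤ (ν * x) * Lh + ν * (1 - C) * A ^ 2 * x * (1 - x) * (ν * x - p * lam) := by
      have t := mul_le_mul_of_nonneg_right hTK hd
      have e : ν * (1 - C) * A ^ 2 * x * (1 - x) * Qr * (ν * x)
          = ν * (1 - C) * A ^ 2 * x * (1 - x) * Qr * (p * lam)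
            + ν * (1 - C) * A ^ 2 * x * (1 - x) * Qr * (ν * x - p * lam) := by ring
      rw [e]; linarith [t, hT]
    have hT2 : ν * (1 - C) * A ^ 2 * x * (1 - x) * Qr ≤ Lh + (1 - C) * A ^ 2 * (1 - x) * (ν * x - p * lam) := by
      have e : (ν * x) * Lh + ν * (1 - C) * A ^ 2 * x * (1 - x) * (ν * x - p * lam)
          = (Lh + (1 - C) * A ^ 2 * (1 - x) * (ν * x - p * lam)) * (ν * x) := by ring
      rw [e] at hsplit
      exact le_of_mul_le_mul_right hsplit hνx
    have e3 : ν * (1 - C) * A ^ 2 * x ^ 2 + (1 - C) * A ^ 2 * (1 - x) * (ν * x - p * lam)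
        = (1 - C) * A ^ 2 * (ν * x - (1 - x) * p * lam) := by ring
    linarith [step1, hT2, e3, hcore]

end PocketCert

end Summit.CriticalPhenomena.PercolationContinuityZ3.Theorems
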